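import Literature.NumberTheory.EllipticCurves.IwasawaAlgebraSpecializationTorsionBoundProofs
import Literature.NumberTheory.EllipticCurves.IwasawaAlgebraEisensteinSpecializationUnitProofs
import HarnessLib

/-!
# Counting `T^k`-torsion on modules over Howard's Eisenstein quotients `S_m = Λ/(T^m + p)`:
# `#V[T^k] ≤ p^{k·r}` for `V` on `r` generators, uniformly in `m` (proofs file)

Topic `NumberTheory/EllipticCurves`. THEOREMS ONLY (no definition, no named fact, no instance, no
`sorry`), in the vocabulary of the tree (`IwasawaAlgebra p = ℤ_p⟦T⟧`, `Submodule.torsionBy`, `Nat.card`).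

WHAT. Let `q_m = T^m + p` (`m ≥ 1`), `S_m = Λ/(q_m) = ℤ_p[π]` (`π` = image of `T`, `π^m = −p`; a
totally ramified discrete valuation ring with residue field `𝔽_p`). For a `Λ`-module `V` killed by
`q_m` (= an `S_m`-module) generated by `r` elements and `k < m`:

* §1 `nat_card_quotient_span_X_pow_sup_span_eq` : `#(Λ/(T^k, q_m)) = p^k` (`= #(S_m/π^k)`);
* §2 `finite_torsionBy_X_pow_of_smul_eq_zero`, `nat_card_torsionBy_X_pow_le_of_cyclic` : for CYCLIC
  `V` (one generator), `V[T^k]` is finite of order `≤ p^k` (either `V ≅ S_m`, a domain, and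
  `V[T^k] = 0`; or `V` is a proper quotient of `S_m`, hence FINITE, and then
  `#V[T^k] = #(V/T^k V) ≤ #(Λ/(T^k, q_m)) = p^k`);
* §3 `nat_card_torsionBy_le_mul_of_submodule` (any ring: `#V[x] ≤ #A[x] · #((V/A)[x])`) and the MAIN
  count `nat_card_torsionBy_X_pow_le_pow_mul` : **`#V[T^k] ≤ p^{k·r}`** for `V` killed by `q_m` with
  `r` generators, by induction on `r`;
* §4 the same count for modules over the quotient ring `S_m` (`nat_card_torsionBy_mk_X_pow_le_pow_mul`,
  scalar-tower bridge) and, combined with the tree's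
  `IwasawaAlgebra.ker_add_onePlusX_pow_sub_one_le_torsionBy_X_pow` (seat x9-p1-w2 g3, p627333):
  `nat_card_ker_add_onePlusX_pow_sub_one_le` : on an `S_m`-module `V` with `r` generators, for a
  nilpotent `N` (`N^n = 0`) and `p^t · n < m`, **`#ker(N + ((1+T)^{p^t} − 1)) ≤ p^{p^t · n · r}`** —
  a bound INDEPENDENT of `m`.

WHY (use). In the control theorem at Howard's Eisenstein primes `𝔮 = q_m` [Howard 2004, Lemma 2.2.7 /
Prop. 2.2.8, and proof of Thm. 2.2.10: "taking `𝔮 = T^m + p`"], the local error term at a place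
`v ∣ p` is the group of invariants `H⁰(K_v, M_v ⊗ S_m(ψ))` of a FINITE Galois module `M_v`
(`= Ẽ(k_{∞,w})[p^∞]`, `m`-independent, on `r` generators) tensored with `S_m` twisted by the
character `ψ : γ ↦ 1 + T`; an element of the decomposition group acts as `φ ⊗ (1+T)^{p^t}` with `φ` of
finite order on `M_v`, i.e. as `1 + (N + ((1+T)^{p^t} − 1))` with `N` nilpotent on the `p`-group.
Print bounds this term by `#(M_v ⊗ S_m) = #M_v^m`, which GROWS with `m`; §4 bounds it by
`p^{p^t·n·r}`, uniformly in `m` — the cardinality currency required by the `m → ∞` limit that reads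
off `μ`-invariants (the tree's `IwasawaAlgebra.lengthAt_le_two_mul_of_card_quotSMulTop_qm_le`; cell
`pub/bsd-print-x9`, crux idea `specialise-first-mu-x10b`, S1 term ledger item (4)). Pure commutative
algebra; nothing about Galois cohomology is asserted here.

References: [Howard2004HeegnerKolyvagin] B. Howard, Compositio Math. 140 (2004), Lemma 2.2.7,
Prop. 2.2.8, proof of Thm. 2.2.10; [Washington1997] §7.1 (Prop. 7.2), §13.2 (Lemma 13.7, Prop. 13.8);
[Serre1979LocalFields] I §6 (Eisenstein polynomials, totally ramified extensions).
-/

noncomputable section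

open scoped Classical Polynomial

universe u

namespace Literature.NumberTheory.EllipticCurves.IwasawaAlgebra

variable (p : ℕ) [hp : Fact p.Prime]

/-! ## §1 `#(Λ/(T^k, q_m)) = p^k` for `k < m` -/

/-- The polynomial `X ∈ ℤ_p[X]` is distinguished (monic, constant coefficient `0 ∈ 𝔪`).
[cite: Washington1997, §7.1 (distinguished polynomials)] -/
theorem isDistinguishedAt_X :
    (Polynomial.X : ℤ_[p][X]).IsDistinguishedAt (IsLocalRing.maximalIdeal ℤ_[p]) := by
  have h := isDistinguishedAt_X_sub_C p (c := 0) (Submodule.zero_mem _)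
  simpa using h

/-- **`#(Λ/(T^k, q_m)) = p^k` for `k < m`** (`(T^k, T^m + p) = (T^k, p)` and `Λ/(T^k) ≅ ℤ_p^k`; i.e.
`#(S_m/π^k S_m) = p^k` in `S_m = Λ/(q_m) = ℤ_p[π]`). [cite: Washington1997, Prop. 13.8 and §13.2]
[cite: Howard2004HeegnerKolyvagin, proof of Thm. 2.2.10 (𝔮 = T^m + p)] -/
theorem nat_card_quotient_span_X_pow_sup_span_eq {k m : ℕ} (hk : k < m) :
    Nat.card (IwasawaAlgebra p ⧸ (Ideal.span {(PowerSeries.X : IwasawaAlgebra p) ^ k} ⊔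
      Ideal.span {(PowerSeries.X ^ m + PowerSeries.C (p : ℤ_[p]) : IwasawaAlgebra p)})) = p ^ k := by
  have h := card_quotient_span_coe_pow_sup_span_qm p (isDistinguishedAt_X p) k (m := m)
    (by rw [Polynomial.natDegree_X, mul_one]; exact hk)
  rw [Polynomial.coe_X, Polynomial.natDegree_X, mul_one] at h
  exact h

/-- `#(Λ/(T^k, q_m))` is finite and non-zero (`= p^k`), `k < m`. [cite: Washington1997, Prop. 13.8] -/
theorem finite_quotient_span_X_pow_sup_span {k m : ℕ} (hk : k < m) :
    Finite (IwasawaAlgebra p ⧸ (Ideal.span {(PowerSeries.X : IwasawaAlgebra p) ^ k} ⊔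
      Ideal.span {(PowerSeries.X ^ m + PowerSeries.C (p : ℤ_[p]) : IwasawaAlgebra p)})) := by
  apply Nat.finite_of_card_ne_zero
  rw [nat_card_quotient_span_X_pow_sup_span_eq p hk]
  exact pow_ne_zero _ hp.out.ne_zero

/-- `q_m = T^m + p` does not divide `T^k` (`m ≥ 1`): otherwise the prime `q_m` divides `T`, `T = q_m c`
forces `c(0) = 0`, `c = T c'`, and `q_m c' = 1`, but `q_m` is not a unit. [cite: Washington1997, §7.1] -/
theorem not_X_pow_add_C_dvd_X_pow {m : ℕ} (hm : 1 ≤ m) (k : ℕ) :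
    ¬ (PowerSeries.X ^ m + PowerSeries.C (p : ℤ_[p]) : IwasawaAlgebra p) ∣ PowerSeries.X ^ k := by
  intro h
  have hX : (PowerSeries.X ^ m + PowerSeries.C (p : ℤ_[p]) : IwasawaAlgebra p) ∣ PowerSeries.X :=
    (prime_X_pow_add_C p hm).dvd_of_dvd_pow h
  obtain ⟨c, hc⟩ := hX
  have h0 : PowerSeries.constantCoeff c = 0 := by
    have := congrArg PowerSeries.constantCoeff hc
    rw [PowerSeries.constantCoeff_X, map_mul, map_add, map_pow, PowerSeries.constantCoeff_X,
      zero_pow (by omega), zero_add, PowerSeries.constantCoeff_C] at this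
    have hp0 : (p : ℤ_[p]) ≠ 0 := by exact_mod_cast hp.out.ne_zero
    exact (mul_eq_zero.mp this.symm).resolve_left hp0
  obtain ⟨c', rfl⟩ := PowerSeries.X_dvd_iff.mpr h0
  have h1 : (PowerSeries.X : IwasawaAlgebra p) * 1 =
      PowerSeries.X * ((PowerSeries.X ^ m + PowerSeries.C (p : ℤ_[p])) * c') :=
    calc (PowerSeries.X : IwasawaAlgebra p) * 1 = PowerSeries.X := mul_one _
      _ = (PowerSeries.X ^ m + PowerSeries.C (p : ℤ_[p])) * (PowerSeries.X * c') := hc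
      _ = PowerSeries.X * ((PowerSeries.X ^ m + PowerSeries.C (p : ℤ_[p])) * c') := by ring
  have h2 := mul_left_cancel₀ PowerSeries.X_ne_zero h1
  exact not_isUnit_X_pow_add_C p hm (IsUnit.of_mul_eq_one c' h2.symm)

section Module

variable {V : Type u} [AddCommGroup V] [Module (IwasawaAlgebra p) V]

/-! ## §2 Finiteness of `V[T^k]`, and the cyclic count `#V[T^k] ≤ p^k` -/

/-- On a finitely generated `Λ`-module killed by `q_m`, the `T^k`-torsion (`k < m`) is FINITE: it is
a finitely generated module over the finite ring `Λ/(T^k, q_m)`.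
[cite: Washington1997, §13.2] [cite: Howard2004HeegnerKolyvagin, proof of Thm. 2.2.10 (𝔮 = T^m + p)] -/
theorem finite_torsionBy_X_pow_of_smul_eq_zero [Module.Finite (IwasawaAlgebra p) V] {k m : ℕ}
    (hk : k < m)
    (hq : ∀ x : V, (PowerSeries.X ^ m + PowerSeries.C (p : ℤ_[p]) : IwasawaAlgebra p) • x = 0) :
    Finite (Submodule.torsionBy (IwasawaAlgebra p) V ((PowerSeries.X : IwasawaAlgebra p) ^ k)) := by
  haveI : IsNoetherian (IwasawaAlgebra p) V := inferInstance
  haveI : Module.Finite (IwasawaAlgebra p)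
      (Submodule.torsionBy (IwasawaAlgebra p) V ((PowerSeries.X : IwasawaAlgebra p) ^ k)) :=
    inferInstance
  haveI := finite_quotient_span_X_pow_sup_span p hk
  refine finite_of_finite_quotient_of_le_annihilator p
    (Ideal.span {(PowerSeries.X : IwasawaAlgebra p) ^ k} ⊔
      Ideal.span {(PowerSeries.X ^ m + PowerSeries.C (p : ℤ_[p]) : IwasawaAlgebra p)}) ?_
  refine sup_le ?_ ?_
  · rw [Ideal.span_singleton_le_iff_mem, Module.mem_annihilator]
    rintro ⟨x, hx⟩
    exact Subtype.ext ((Submodule.mem_torsionBy_iff _ _).mp hx)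
  · rw [Ideal.span_singleton_le_iff_mem, Module.mem_annihilator]
    rintro ⟨x, hx⟩
    exact Subtype.ext (hq x)

/-- On a FINITE module, the kernel and the cokernel of multiplication by a scalar have the same
cardinality (`#V = #ker · #image = #image · #coker`). [cite: Washington1997, §13.2 (Herbrand-type count)] -/
theorem nat_card_torsionBy_eq_nat_card_quotient_of_finite {R : Type*} [CommRing R] {W : Type*}
    [AddCommGroup W] [Module R W] [Finite W] (x : R) :
    Nat.card (Submodule.torsionBy R W x) =
      Nat.card (W ⧸ (Ideal.span {x} • ⊤ : Submodule R W)) := by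
  let φ : W →ₗ[R] W := DistribSMul.toLinearMap R W x
  have hker : LinearMap.ker φ = Submodule.torsionBy R W x := rfl
  have hrange : LinearMap.range φ = (Ideal.span {x} • ⊤ : Submodule R W) := by
    rw [Submodule.ideal_span_singleton_smul]
    ext w
    simp only [φ, LinearMap.mem_range, DistribSMul.toLinearMap_apply,
      Submodule.mem_smul_pointwise_iff_exists, Submodule.mem_top, true_and]
  have h1 : Nat.card W = Nat.card (LinearMap.ker φ) * Nat.card (LinearMap.range φ) := by
    rw [Submodule.card_eq_card_quotient_mul_card (LinearMap.ker φ),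
      Nat.card_congr φ.quotKerEquivRange.toEquiv, mul_comm]
  have h2 : Nat.card W = Nat.card (W ⧸ LinearMap.range φ) * Nat.card (LinearMap.range φ) := by
    rw [Submodule.card_eq_card_quotient_mul_card (LinearMap.range φ), mul_comm]
  have hpos : 0 < Nat.card (LinearMap.range φ) := Nat.card_pos
  have h3 : Nat.card (LinearMap.ker φ) = Nat.card (W ⧸ LinearMap.range φ) :=
    Nat.eq_of_mul_eq_mul_right hpos (h1.symm.trans h2)
  rw [← hker, h3, hrange]

/-- **Cyclic count.** Let `V` be a CYCLIC `Λ`-module (`V = Λ·c`) killed by `q_m = T^m + p`, and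
`k < m`. Then `V[T^k]` is finite with `#V[T^k] ≤ p^k`. Either every annihilator of `c` is a multiple of
the prime `q_m` — then `V ≅ S_m = Λ/(q_m)` is torsion-free over the domain `S_m` and `V[T^k] = 0`
(`q_m ∤ T^k`) — or some annihilator `x` has `q_m ∤ x`, so `V` is finite (`Λ/(x, q_m)` is) and
`#V[T^k] = #(V/T^kV) ≤ #(Λ/(T^k, q_m)) = p^k`. (In `S_m = ℤ_p[π]`: `#(S_m/π^j)[π^k] = p^{min(j,k)}`.)
[cite: Washington1997, Prop. 13.8 and §13.2] [cite: Howard2004HeegnerKolyvagin, proof of Thm. 2.2.10 (𝔮 = T^m + p)] -/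
theorem nat_card_torsionBy_X_pow_le_of_cyclic {k m : ℕ} (hk : k < m) (c : V)
    (hc : ∀ x : V, ∃ a : IwasawaAlgebra p, a • c = x)
    (hq : ∀ x : V, (PowerSeries.X ^ m + PowerSeries.C (p : ℤ_[p]) : IwasawaAlgebra p) • x = 0) :
    Finite (Submodule.torsionBy (IwasawaAlgebra p) V ((PowerSeries.X : IwasawaAlgebra p) ^ k)) ∧
    Nat.card (Submodule.torsionBy (IwasawaAlgebra p) V ((PowerSeries.X : IwasawaAlgebra p) ^ k)) ≤
      p ^ k := by
  have hm : 1 ≤ m := by omega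
  set q : IwasawaAlgebra p := PowerSeries.X ^ m + PowerSeries.C (p : ℤ_[p]) with hqdef
  haveI : Module.Finite (IwasawaAlgebra p) V := by
    refine ⟨⟨{c}, ?_⟩⟩
    rw [Finset.coe_singleton, eq_top_iff]
    intro x _
    obtain ⟨a, rfl⟩ := hc x
    exact Submodule.smul_mem _ a (Submodule.mem_span_singleton_self c)
  have hfin := finite_torsionBy_X_pow_of_smul_eq_zero p hk hq
  refine ⟨hfin, ?_⟩
  by_cases hall : ∀ a : IwasawaAlgebra p, a • c = 0 → q ∣ a
  · -- `V ≅ Λ/(q_m)`: the `T^k`-torsion vanishes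
    have hbot : Submodule.torsionBy (IwasawaAlgebra p) V ((PowerSeries.X : IwasawaAlgebra p) ^ k) = ⊥ := by
      rw [eq_bot_iff]
      intro x hx
      rw [Submodule.mem_torsionBy_iff] at hx
      obtain ⟨a, rfl⟩ := hc x
      rw [smul_smul] at hx
      have hdvd : q ∣ PowerSeries.X ^ k * a := hall _ hx
      have hqa : q ∣ a := by
        rcases (prime_X_pow_add_C p hm).dvd_or_dvd hdvd with h | h
        · exact absurd h (not_X_pow_add_C_dvd_X_pow p hm k)
        · exact h
      obtain ⟨b, rfl⟩ := hqa
      rw [Submodule.mem_bot, mul_comm, ← smul_smul, hq, smul_zero]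
    rw [hbot]
    have : Nat.card (⊥ : Submodule (IwasawaAlgebra p) V) = 1 := by simp
    rw [this]
    exact Nat.one_le_pow _ _ hp.out.pos
  · -- some annihilator `a` of `c` is prime to `q_m`: `V` is finite
    push Not at hall
    obtain ⟨a, hac, hna⟩ := hall
    haveI : Finite V := by
      refine finite_of_smul_eq_zero_of_not_X_pow_add_C_dvd p hm hna (fun x => ?_) hq
      obtain ⟨b, rfl⟩ := hc x
      rw [smul_smul, mul_comm, ← smul_smul, hac, smul_zero]
    rw [nat_card_torsionBy_eq_nat_card_quotient_of_finite]
    -- `V / T^k V` is a quotient of `Λ/(T^k, q_m)`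
    haveI := finite_quotient_span_X_pow_sup_span p hk
    rw [← nat_card_quotient_span_X_pow_sup_span_eq p hk]
    let N : Submodule (IwasawaAlgebra p) V :=
      (Ideal.span {(PowerSeries.X : IwasawaAlgebra p) ^ k} • ⊤ : Submodule (IwasawaAlgebra p) V)
    let ψ : IwasawaAlgebra p →ₗ[IwasawaAlgebra p] V ⧸ N :=
      N.mkQ ∘ₗ (LinearMap.toSpanSingleton (IwasawaAlgebra p) V c)
    have hψs : Function.Surjective ψ := by
      intro y
      obtain ⟨x, rfl⟩ := Submodule.mkQ_surjective N y
      obtain ⟨b, rfl⟩ := hc x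
      exact ⟨b, by simp [ψ, LinearMap.toSpanSingleton_apply]⟩
    have hker : Ideal.span {(PowerSeries.X : IwasawaAlgebra p) ^ k} ⊔ Ideal.span {q} ≤
        LinearMap.ker ψ := by
      refine sup_le ?_ ?_
      · rw [Ideal.span_singleton_le_iff_mem, LinearMap.mem_ker]
        simp only [ψ, LinearMap.coe_comp, Function.comp_apply, LinearMap.toSpanSingleton_apply,
          Submodule.mkQ_apply, Submodule.Quotient.mk_eq_zero]
        exact Submodule.smul_mem_smul (Ideal.mem_span_singleton_self _) Submodule.mem_top
      · rw [Ideal.span_singleton_le_iff_mem, LinearMap.mem_ker]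
        simp only [ψ, LinearMap.coe_comp, Function.comp_apply, LinearMap.toSpanSingleton_apply,
          Submodule.mkQ_apply, hq, Submodule.Quotient.mk_zero]
    -- `Λ/(T^k, q_m) ↠ Λ/ker ψ ≅ V/N`
    let θ : (IwasawaAlgebra p ⧸ (Ideal.span {(PowerSeries.X : IwasawaAlgebra p) ^ k} ⊔ Ideal.span {q})) →ₗ[IwasawaAlgebra p]
        V ⧸ N :=
      Submodule.liftQ _ ψ hker
    have hθs : Function.Surjective θ := by
      intro y
      obtain ⟨b, rfl⟩ := hψs y
      exact ⟨Submodule.Quotient.mk b, rfl⟩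
    exact Nat.card_le_card_of_surjective θ hθs

/-! ## §3 `#V[x] ≤ #A[x] · #(V/A)[x]`, and the main count `#V[T^k] ≤ p^{k·r}` -/

/-- **Torsion count along a submodule.** For a submodule `A ≤ V` and a scalar `x` with `A[x]` and
`(V/A)[x]` finite: `V[x]` is finite and `#V[x] ≤ #A[x] · #((V/A)[x])` (the map `V[x] → (V/A)[x]` has
kernel `A[x]`). Any commutative ring. [cite: Washington1997, §13.2 (Herbrand-type count)] -/
theorem nat_card_torsionBy_le_mul_of_submodule {R : Type*} [CommRing R] {W : Type*} [AddCommGroup W]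
    [Module R W] (A : Submodule R W) (x : R) [hA : Finite (Submodule.torsionBy R A x)]
    [hQ : Finite (Submodule.torsionBy R (W ⧸ A) x)] :
    Finite (Submodule.torsionBy R W x) ∧
      Nat.card (Submodule.torsionBy R W x) ≤
        Nat.card (Submodule.torsionBy R A x) * Nat.card (Submodule.torsionBy R (W ⧸ A) x) := by
  have hmap : ∀ w ∈ Submodule.torsionBy R W x, A.mkQ w ∈ Submodule.torsionBy R (W ⧸ A) x := by
    intro w hw
    rw [Submodule.mem_torsionBy_iff] at hw ⊢
    rw [← map_smul, hw, map_zero]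
  set φ : Submodule.torsionBy R W x →ₗ[R] Submodule.torsionBy R (W ⧸ A) x :=
    A.mkQ.restrict hmap with hφ
  -- the kernel of `φ` embeds into `A[x]`
  have hkerA : ∀ w : LinearMap.ker φ, ((w : Submodule.torsionBy R W x) : W) ∈ A := by
    rintro ⟨⟨w, hw⟩, hk⟩
    have hk' : φ ⟨w, hw⟩ = 0 := hk
    have : A.mkQ w = 0 := congrArg Subtype.val hk'
    rwa [Submodule.mkQ_apply, Submodule.Quotient.mk_eq_zero] at this
  let ι : LinearMap.ker φ → Submodule.torsionBy R A x := fun w =>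
    ⟨⟨((w : Submodule.torsionBy R W x) : W), hkerA w⟩, by
      rw [Submodule.mem_torsionBy_iff]
      apply Subtype.ext
      have := (Submodule.mem_torsionBy_iff _ _).mp (w : Submodule.torsionBy R W x).2
      rw [Submodule.coe_smul, Submodule.coe_zero]
      exact this⟩
  have hι : Function.Injective ι := by
    intro a b hab
    have := congrArg (fun z : Submodule.torsionBy R A x => ((z : A) : W)) hab
    exact Subtype.ext (Subtype.ext this)
  haveI hkfin : Finite (LinearMap.ker φ) := Finite.of_injective ι hι
  have hkcard : Nat.card (LinearMap.ker φ) ≤ Nat.card (Submodule.torsionBy R A x) :=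
    Nat.card_le_card_of_injective ι hι
  -- the image of `φ` sits inside `(V/A)[x]`
  haveI hrfin : Finite (LinearMap.range φ) :=
    Finite.of_injective _ (LinearMap.range φ).injective_subtype
  have hrcard : Nat.card (Submodule.torsionBy R W x ⧸ LinearMap.ker φ) ≤
      Nat.card (Submodule.torsionBy R (W ⧸ A) x) := by
    rw [Nat.card_congr φ.quotKerEquivRange.toEquiv]
    exact Nat.card_le_card_of_injective _ (LinearMap.range φ).injective_subtype
  haveI hqfin : Finite (Submodule.torsionBy R W x ⧸ LinearMap.ker φ) :=
    Finite.of_equiv _ φ.quotKerEquivRange.toEquiv.symm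
  have hcard := Submodule.card_eq_card_quotient_mul_card (LinearMap.ker φ)
    (M := Submodule.torsionBy R W x)
  have hfin : Finite (Submodule.torsionBy R W x) := by
    apply Nat.finite_of_card_ne_zero
    rw [hcard]
    exact Nat.mul_ne_zero Nat.card_pos.ne' Nat.card_pos.ne'
  refine ⟨hfin, ?_⟩
  rw [hcard, mul_comm]
  exact Nat.mul_le_mul hrcard hkcard |>.trans (le_of_eq (mul_comm _ _))

/-- **Main count: `#V[T^k] ≤ p^{k·r}` for a `Λ`-module `V` killed by `q_m = T^m + p` and generated by
`r` elements, `k < m`** — uniformly in `m`. Induction on `r`: split off the cyclic submodule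
`A = Λ·v₀` (`#A[T^k] ≤ p^k`, §2) and apply the induction hypothesis to `V/A` (generated by the `r`
remaining images), with `#V[T^k] ≤ #A[T^k] · #(V/A)[T^k]`. (Over the DVR `S_m = ℤ_p[π]`: `V ≅ S_m^f ⊕
⨁_{i ≤ r−f} S_m/π^{jᵢ}` and `#V[π^k] = p^{Σ min(jᵢ,k)}`.) [cite: Washington1997, §13.2 and Prop. 13.8]
[cite: Howard2004HeegnerKolyvagin, Lemma 2.2.7 and proof of Thm. 2.2.10 (𝔮 = T^m + p)] -/
theorem nat_card_torsionBy_X_pow_le_pow_mul {k m : ℕ} (hk : k < m) :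
    ∀ (r : ℕ) (W : Type u) [AddCommGroup W] [Module (IwasawaAlgebra p) W] (v : Fin r → W),
      Submodule.span (IwasawaAlgebra p) (Set.range v) = ⊤ →
      (∀ x : W, (PowerSeries.X ^ m + PowerSeries.C (p : ℤ_[p]) : IwasawaAlgebra p) • x = 0) →
      Finite (Submodule.torsionBy (IwasawaAlgebra p) W ((PowerSeries.X : IwasawaAlgebra p) ^ k)) ∧
      Nat.card (Submodule.torsionBy (IwasawaAlgebra p) W ((PowerSeries.X : IwasawaAlgebra p) ^ k)) ≤
        p ^ (k * r) := by
  intro r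
  induction r with
  | zero =>
    intro W _ _ v hv _
    have hW : Subsingleton W := by
      rw [Set.range_eq_empty v, Submodule.span_empty] at hv
      refine ⟨fun a b => ?_⟩
      have ha : a ∈ (⊥ : Submodule (IwasawaAlgebra p) W) := by rw [hv]; trivial
      have hb : b ∈ (⊥ : Submodule (IwasawaAlgebra p) W) := by rw [hv]; trivial
      rw [Submodule.mem_bot] at ha hb
      rw [ha, hb]
    haveI : Finite W := Finite.of_subsingleton
    refine ⟨inferInstance, ?_⟩
    rw [mul_zero, pow_zero]
    haveI : Subsingleton (Submodule.torsionBy (IwasawaAlgebra p) W ((PowerSeries.X : IwasawaAlgebra p) ^ k)) :=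
      inferInstance
    exact le_of_eq (Nat.card_of_subsingleton (0 : Submodule.torsionBy (IwasawaAlgebra p) W _))
  | succ r ih =>
    intro W _ _ v hv hq
    -- split off the cyclic submodule generated by `v 0`
    set A : Submodule (IwasawaAlgebra p) W := Submodule.span (IwasawaAlgebra p) {v 0} with hA
    -- the cyclic piece
    have hcyc := nat_card_torsionBy_X_pow_le_of_cyclic p hk (V := A) ⟨v 0, Submodule.mem_span_singleton_self _⟩
      (by
        rintro ⟨x, hx⟩
        obtain ⟨a, rfl⟩ := Submodule.mem_span_singleton.mp hx
        exact ⟨a, rfl⟩)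
      (fun x => Subtype.ext (hq x))
    haveI := hcyc.1
    -- the quotient is generated by the `r` remaining images
    have hvsplit : Set.range v = insert (v 0) (Set.range (Fin.tail v)) := by
      conv_lhs => rw [← Fin.cons_self_tail v]
      exact Fin.range_cons _ _
    have hspan : Submodule.span (IwasawaAlgebra p) (Set.range (A.mkQ ∘ Fin.tail v)) = ⊤ := by
      rw [Set.range_comp, Submodule.span_image]
      have h1 : Submodule.map A.mkQ (Submodule.span (IwasawaAlgebra p) (Set.range v)) = ⊤ := by
        rw [hv, Submodule.map_top, Submodule.range_mkQ]
      rw [hvsplit, Submodule.span_insert, Submodule.map_sup, ← hA, Submodule.mkQ_map_self,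
        bot_sup_eq] at h1
      exact h1
    have hq' : ∀ x : W ⧸ A, (PowerSeries.X ^ m + PowerSeries.C (p : ℤ_[p]) : IwasawaAlgebra p) • x = 0 := by
      intro x
      obtain ⟨y, rfl⟩ := Submodule.mkQ_surjective A x
      rw [← map_smul, hq, map_zero]
    have hquot := ih (W ⧸ A) (A.mkQ ∘ Fin.tail v) hspan hq'
    haveI := hquot.1
    have hcount := nat_card_torsionBy_le_mul_of_submodule A ((PowerSeries.X : IwasawaAlgebra p) ^ k)
    refine ⟨hcount.1, hcount.2.trans ?_⟩
    calc Nat.card (Submodule.torsionBy (IwasawaAlgebra p) A ((PowerSeries.X : IwasawaAlgebra p) ^ k)) *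
          Nat.card (Submodule.torsionBy (IwasawaAlgebra p) (W ⧸ A) ((PowerSeries.X : IwasawaAlgebra p) ^ k))
        ≤ p ^ k * p ^ (k * r) := Nat.mul_le_mul hcyc.2 hquot.2
      _ = p ^ (k * (r + 1)) := by rw [← pow_add]; ring_nf

/-- **Main count, finitely-generated form**: a `Λ`-module killed by `q_m` and generated by a finite set
`s` has `#V[T^k] ≤ p^{k·#s}` for `k < m`. [cite: Washington1997, §13.2 and Prop. 13.8]
[cite: Howard2004HeegnerKolyvagin, Lemma 2.2.7 and proof of Thm. 2.2.10 (𝔮 = T^m + p)] -/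
theorem nat_card_torsionBy_X_pow_le_pow_mul_card {k m : ℕ} (hk : k < m) (s : Finset V)
    (hs : Submodule.span (IwasawaAlgebra p) (s : Set V) = ⊤)
    (hq : ∀ x : V, (PowerSeries.X ^ m + PowerSeries.C (p : ℤ_[p]) : IwasawaAlgebra p) • x = 0) :
    Finite (Submodule.torsionBy (IwasawaAlgebra p) V ((PowerSeries.X : IwasawaAlgebra p) ^ k)) ∧
    Nat.card (Submodule.torsionBy (IwasawaAlgebra p) V ((PowerSeries.X : IwasawaAlgebra p) ^ k)) ≤
      p ^ (k * s.card) := by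
  have hv : Submodule.span (IwasawaAlgebra p) (Set.range (fun i : Fin s.card => (s.equivFin.symm i : V))) = ⊤ := by
    have : Set.range (fun i : Fin s.card => (s.equivFin.symm i : V)) = (s : Set V) := by
      ext x
      constructor
      · rintro ⟨i, rfl⟩; exact (s.equivFin.symm i).2
      · intro hx; exact ⟨s.equivFin ⟨x, hx⟩, by simp⟩
    rw [this, hs]
  exact nat_card_torsionBy_X_pow_le_pow_mul p hk s.card V _ hv hq

end Module

/-! ## §4 Modules over the quotient ring `S_m = Λ/(q_m)`; the `m`-uniform error-term bound -/

section QuotientRing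

variable {V : Type u} [AddCommGroup V]

/-- Scalar-tower bridge: on an `S_m = Λ/(q_m)`-module regarded as a `Λ`-module, the torsion by the
class of `a` and the torsion by `a` have the same elements (so the same cardinality). [folklore] -/
private theorem mem_torsionBy_mk_iff {m : ℕ}
    [Module (IwasawaAlgebra p) V]
    [Module (IwasawaAlgebra p ⧸
      Ideal.span {(PowerSeries.X ^ m + PowerSeries.C (p : ℤ_[p]) : IwasawaAlgebra p)}) V]
    [IsScalarTower (IwasawaAlgebra p) (IwasawaAlgebra p ⧸
      Ideal.span {(PowerSeries.X ^ m + PowerSeries.C (p : ℤ_[p]) : IwasawaAlgebra p)}) V]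
    (a : IwasawaAlgebra p) (x : V) :
    x ∈ Submodule.torsionBy (IwasawaAlgebra p ⧸
        Ideal.span {(PowerSeries.X ^ m + PowerSeries.C (p : ℤ_[p]) : IwasawaAlgebra p)}) V
        (Ideal.Quotient.mk _ a) ↔
      x ∈ Submodule.torsionBy (IwasawaAlgebra p) V a := by
  rw [Submodule.mem_torsionBy_iff, Submodule.mem_torsionBy_iff, ← Ideal.Quotient.algebraMap_eq,
    IsScalarTower.algebraMap_smul]

/-- **Main count over `S_m`.** Let `V` be a module over `S_m = Λ/(T^m + p)` (with its `Λ`-structure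
through `Λ → S_m`), generated by `r` elements, and `k < m`. Then `V[π^k]` is finite with
`#V[π^k] ≤ p^{k·r}` (`π` = the class of `T`). [cite: Washington1997, §13.2 and Prop. 13.8]
[cite: Howard2004HeegnerKolyvagin, Lemma 2.2.7 and proof of Thm. 2.2.10 (𝔮 = T^m + p)] -/
theorem nat_card_torsionBy_mk_X_pow_le_pow_mul {k m r : ℕ} (hk : k < m)
    [Module (IwasawaAlgebra p) V]
    [Module (IwasawaAlgebra p ⧸
      Ideal.span {(PowerSeries.X ^ m + PowerSeries.C (p : ℤ_[p]) : IwasawaAlgebra p)}) V]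
    [IsScalarTower (IwasawaAlgebra p) (IwasawaAlgebra p ⧸
      Ideal.span {(PowerSeries.X ^ m + PowerSeries.C (p : ℤ_[p]) : IwasawaAlgebra p)}) V]
    (v : Fin r → V)
    (hv : Submodule.span (IwasawaAlgebra p ⧸
      Ideal.span {(PowerSeries.X ^ m + PowerSeries.C (p : ℤ_[p]) : IwasawaAlgebra p)}) (Set.range v) = ⊤) :
    Finite (Submodule.torsionBy (IwasawaAlgebra p ⧸
        Ideal.span {(PowerSeries.X ^ m + PowerSeries.C (p : ℤ_[p]) : IwasawaAlgebra p)}) V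
        (Ideal.Quotient.mk _ (PowerSeries.X ^ k))) ∧
    Nat.card (Submodule.torsionBy (IwasawaAlgebra p ⧸
        Ideal.span {(PowerSeries.X ^ m + PowerSeries.C (p : ℤ_[p]) : IwasawaAlgebra p)}) V
        (Ideal.Quotient.mk _ (PowerSeries.X ^ k))) ≤ p ^ (k * r) := by
  -- generators over `Λ`
  have hvΛ : Submodule.span (IwasawaAlgebra p) (Set.range v) = ⊤ := by
    have h := Submodule.restrictScalars_span (IwasawaAlgebra p) (IwasawaAlgebra p ⧸
      Ideal.span {(PowerSeries.X ^ m + PowerSeries.C (p : ℤ_[p]) : IwasawaAlgebra p)})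
      Ideal.Quotient.mk_surjective (Set.range v)
    rw [hv, Submodule.restrictScalars_top] at h
    exact h.symm
  -- `q_m` kills `V`
  have hq : ∀ x : V, (PowerSeries.X ^ m + PowerSeries.C (p : ℤ_[p]) : IwasawaAlgebra p) • x = 0 := by
    intro x
    rw [← IsScalarTower.algebraMap_smul (IwasawaAlgebra p ⧸
      Ideal.span {(PowerSeries.X ^ m + PowerSeries.C (p : ℤ_[p]) : IwasawaAlgebra p)}),
      Ideal.Quotient.algebraMap_eq,
      Ideal.Quotient.eq_zero_iff_mem.mpr (Ideal.mem_span_singleton_self _)]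
    exact zero_smul (IwasawaAlgebra p ⧸
      Ideal.span {(PowerSeries.X ^ m + PowerSeries.C (p : ℤ_[p]) : IwasawaAlgebra p)}) x
  have h := nat_card_torsionBy_X_pow_le_pow_mul p hk r V v hvΛ hq
  -- same carrier
  have e : Submodule.torsionBy (IwasawaAlgebra p ⧸
        Ideal.span {(PowerSeries.X ^ m + PowerSeries.C (p : ℤ_[p]) : IwasawaAlgebra p)}) V
        (Ideal.Quotient.mk _ (PowerSeries.X ^ k)) ≃
      Submodule.torsionBy (IwasawaAlgebra p) V ((PowerSeries.X : IwasawaAlgebra p) ^ k) :=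
    { toFun := fun x => ⟨x.1, (mem_torsionBy_mk_iff p _ _).mp x.2⟩
      invFun := fun x => ⟨x.1, (mem_torsionBy_mk_iff p _ _).mpr x.2⟩
      left_inv := fun x => rfl
      right_inv := fun x => rfl }
  haveI := h.1
  exact ⟨Finite.of_equiv _ e.symm, (Nat.card_congr e).trans_le h.2⟩

/-- **The `m`-uniform local error-term bound at Howard's Eisenstein primes.** Let `V` be a module over
`S_m = Λ/(T^m + p)` generated by `r` elements, `N` a nilpotent `S_m`-endomorphism of `V` (`N^n = 0`), and
`p^t · n < m` (so `p^t ≤ m`). Then the kernel of `N + ((1+T)^{p^t} − 1)` — the invariants of an operator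
`(1 + N)·(1+T)^{p^t}`-type, e.g. an element of the decomposition group at `v ∣ p` acting on
`M_v ⊗ S_m(ψ)` — is finite of order at most `p^{p^t · n · r}`, a bound INDEPENDENT of `m`
(kernel `⊆ V[π^{p^t n}]` by the tree's `ker_add_onePlusX_pow_sub_one_le_torsionBy_X_pow`, and
`#V[π^{p^t n}] ≤ p^{p^t n r}`). [cite: Howard2004HeegnerKolyvagin, Lemma 2.2.7 and proof of Thm. 2.2.10 (𝔮 = T^m + p)]
[cite: Washington1997, §13.2] -/
theorem nat_card_ker_add_onePlusX_pow_sub_one_le {t n m r : ℕ} (hm : p ^ t * n < m)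
    [Module (IwasawaAlgebra p) V]
    [Module (IwasawaAlgebra p ⧸
      Ideal.span {(PowerSeries.X ^ m + PowerSeries.C (p : ℤ_[p]) : IwasawaAlgebra p)}) V]
    [IsScalarTower (IwasawaAlgebra p) (IwasawaAlgebra p ⧸
      Ideal.span {(PowerSeries.X ^ m + PowerSeries.C (p : ℤ_[p]) : IwasawaAlgebra p)}) V]
    (v : Fin r → V)
    (hv : Submodule.span (IwasawaAlgebra p ⧸
      Ideal.span {(PowerSeries.X ^ m + PowerSeries.C (p : ℤ_[p]) : IwasawaAlgebra p)}) (Set.range v) = ⊤)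
    (N : V →ₗ[IwasawaAlgebra p ⧸
      Ideal.span {(PowerSeries.X ^ m + PowerSeries.C (p : ℤ_[p]) : IwasawaAlgebra p)}] V)
    (hN : N ^ n = 0) :
    Finite (LinearMap.ker (N +
        (Ideal.Quotient.mk
          (Ideal.span {(PowerSeries.X ^ m + PowerSeries.C (p : ℤ_[p]) : IwasawaAlgebra p)})
          (((1 : IwasawaAlgebra p) + PowerSeries.X) ^ (p ^ t) - 1)) • LinearMap.id)) ∧
    Nat.card (LinearMap.ker (N +
        (Ideal.Quotient.mk
          (Ideal.span {(PowerSeries.X ^ m + PowerSeries.C (p : ℤ_[p]) : IwasawaAlgebra p)})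
          (((1 : IwasawaAlgebra p) + PowerSeries.X) ^ (p ^ t) - 1)) • LinearMap.id)) ≤
      p ^ (p ^ t * n * r) := by
  rcases Nat.eq_zero_or_pos n with hn0 | hn
  · -- degenerate case `n = 0`: `N ^ 0 = 1 = 0` in `End V`, so `V` is a subsingleton
    subst hn0
    have h1 : (1 : V →ₗ[IwasawaAlgebra p ⧸
        Ideal.span {(PowerSeries.X ^ m + PowerSeries.C (p : ℤ_[p]) : IwasawaAlgebra p)}] V) = 0 := by
      rw [← pow_zero N]; exact hN
    have hV : Subsingleton V := ⟨fun a b => by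
      have ha : (1 : V →ₗ[IwasawaAlgebra p ⧸
        Ideal.span {(PowerSeries.X ^ m + PowerSeries.C (p : ℤ_[p]) : IwasawaAlgebra p)}] V) a = 0 := by
        rw [h1]; rfl
      have hb : (1 : V →ₗ[IwasawaAlgebra p ⧸
        Ideal.span {(PowerSeries.X ^ m + PowerSeries.C (p : ℤ_[p]) : IwasawaAlgebra p)}] V) b = 0 := by
        rw [h1]; rfl
      rw [Module.End.one_apply] at ha hb
      rw [ha, hb]⟩
    haveI : Finite V := Finite.of_subsingleton
    refine ⟨inferInstance, ?_⟩
    calc Nat.card _ = 1 := Nat.card_of_subsingleton (0 : LinearMap.ker (N +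
        (Ideal.Quotient.mk
          (Ideal.span {(PowerSeries.X ^ m + PowerSeries.C (p : ℤ_[p]) : IwasawaAlgebra p)})
          (((1 : IwasawaAlgebra p) + PowerSeries.X) ^ (p ^ t) - 1)) • LinearMap.id))
      _ ≤ p ^ (p ^ t * 0 * r) := Nat.one_le_pow _ _ hp.out.pos
  have hpt : p ^ t ≤ m := le_trans (Nat.le_mul_of_pos_right _ hn) hm.le
  have hker := ker_add_onePlusX_pow_sub_one_le_torsionBy_X_pow p hpt N hN
  rw [← map_pow, ← pow_mul] at hker
  have hcount := nat_card_torsionBy_mk_X_pow_le_pow_mul p (k := p ^ t * n) hm v hv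
  haveI := hcount.1
  have hinj := Submodule.inclusion_injective hker
  exact ⟨Finite.of_injective _ hinj, (Nat.card_le_card_of_injective _ hinj).trans hcount.2⟩

end QuotientRing

end Literature.NumberTheory.EllipticCurves.IwasawaAlgebra

end
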